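import Literature.AlgebraicGeometry.Morphisms.CechModuleH2OrderedTransport
import Literature.AlgebraicGeometry.AbelianSchemes.AbelianVarietyCechMulTwo
import HarnessLib

/-!
# `[2]^* = 4` on `Ȟ²(𝒪)` of an abelian variety over a field of characteristic `0`, in the RAW module Čech currency of an
# arbitrary refinement (Mumford, *Abelian Varieties* §13 Cor. 2; The Stacks Project, Tags 01FG, 01XD)

Layer `Literature/AlgebraicGeometry/AbelianSchemes`; namespace `Literature.AlgebraicGeometry.AbelianSchemes.AbelianSchemeOver`.  PROOF file
(one theorem; no definition, no instance, no notation, no named fact, no `sorry`).  Cell `hodgecm-mathlib` FLOOR 0, P1 sub-line F-11,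
MONO-G1 slot (5) **`hrel₃`** of the IV5 socket cert (B-p14 (g21) `socket_GAP2_abelian_datum_of_slots`), road N1–N4 (F0P1b-plan (g2)
(R109)): THE PIN — N1 (★ `AbelianVarietyCech.homologyMap_mulTwo_degree_two`, F0P1b-p01 (g2): `[2]^* x = (2·2) • ref x` on the ORDERED
classes of the diagonal cover of a finite affine cover) transported by N4 (★ `Morphisms.CechMH2.mk_refineC2_comapC2_eq_smul_of_ordered`,
F0P1b-p04 (g2)) to the raw module Čech classes of every pair of refining families.  HC_CM is proved only modulo the 7 printed citations
until rung 0 closes — nothing here bears on a summit statement.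

* **`AbelianSchemeOver.cechMH2_mk_refine_comap_mulN_two`** — for an abelian scheme `B` over `Spec k`, `k` a field of characteristic
  `0`, an affine open cover `𝓤` of `B` (any index type), a raw `2`-cocycle `z` of `𝒪_B` on `𝓤`, and affine opens `W_s` (any index
  type, no covering asked) with `W_s ⊆ U_{τ s}` and `W_s ⊆ [2]⁻¹ U_{τ′ s}`:
  `[ρ_{τ′}([2]^* z)] = (2·2) • [ρ_τ z]` in `Ȟ²(𝓦, 𝒪_B)` (★ `Morphisms/CechModuleH2`), `[2] := (B.mulN 2).left`.
  At `B := A₀ ×_(A⧸J) k` this is the hypothesis `hrel₃` of the GAP-2 closer, token for token.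

## References
* D. Mumford, *Abelian Varieties* (1970), §13 Cor. 2 (p. 129) (`H^*(A, 𝒪_A) = Λ^* H¹`, `[n]^*` on `H¹`). [MumfordAV1970]
* The Stacks Project, Tags 01FG, 01XD. [StacksProject]
-/

noncomputable section

set_option backward.isDefEq.respectTransparency false

open CategoryTheory CategoryTheory.Limits AlgebraicGeometry TopologicalSpace Opposite
open Literature.AlgebraicGeometry.Morphisms Literature.AlgebraicGeometry.Modules

namespace Literature.AlgebraicGeometry.AbelianSchemes.AbelianSchemeOver

/-- **`[2]^* = 4` on `Ȟ²(𝒪_B)`, raw module Čech currency, arbitrary refinement.**  For an abelian scheme `B` over a field `k` of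
characteristic `0`, an affine open cover `𝓤`, a raw `2`-cocycle `z` of `𝒪_B` on `𝓤` and affine opens `W_s ⊆ U_{τ s} ∩ [2]⁻¹U_{τ′ s}`:
`[ρ_{τ′}([2]^* z)] = (2·2) • [ρ_τ z]` in `Ȟ²(𝓦, 𝒪_B)` — N1 (ordered classes, ★ `homologyMap_mulTwo_degree_two`) transported by N4
(★ `CechMH2.mk_refineC2_comapC2_eq_smul_of_ordered`); `B` is separated and compact over `k` because proper.
[cite: MumfordAV1970, §13 Cor. 2 (p. 129)] [cite: StacksProject, Tag 01XD] -/
theorem cechMH2_mk_refine_comap_mulN_two {k : Type} [Field k] [CharZero k] (B : AbelianSchemeOver (Spec (.of k)))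
    {ι : Type} (U : ι → B.X.left.affineOpens) (hU : ⨆ j, (U j).1 = ⊤)
    (z : cechMZ2 B.X.hom (SheafOfModules.unit B.X.left.ringCatSheaf) (fun j => (U j).1))
    {κ : Type} (W : κ → B.X.left.affineOpens) (τ τ' : κ → ι)
    (hτ : ∀ s, (W s).1 ≤ (U (τ s)).1) (hτ' : ∀ s, (W s).1 ≤ (B.mulN 2).left ⁻¹ᵁ (U (τ' s)).1) :
    CechMH2.mk B.X.hom (SheafOfModules.unit B.X.left.ringCatSheaf) (fun s => (W s).1)
        ⟨cechMRefineC2 B.X.hom (SheafOfModules.unit B.X.left.ringCatSheaf) (preimageFamily (B.mulN 2).left (fun j => (U j).1))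
            (fun s => (W s).1) τ' hτ'
            (cechComapC2 B.X.hom B.X.hom (B.mulN 2).left (Over.w (B.mulN 2)) (fun j => (U j).1)
              (z : CechMC2 B.X.hom (SheafOfModules.unit B.X.left.ringCatSheaf) (fun j => (U j).1))),
          refineMC2_mem_cechMZ2 B.X.hom (SheafOfModules.unit B.X.left.ringCatSheaf) (preimageFamily (B.mulN 2).left (fun j => (U j).1))
            (fun s => (W s).1) τ' hτ' (comapC2_mem_cechMZ2 B.X.hom B.X.hom (B.mulN 2).left (Over.w (B.mulN 2)) (fun j => (U j).1) z.2)⟩ =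
      ((2 : k) * 2) • CechMH2.mk B.X.hom (SheafOfModules.unit B.X.left.ringCatSheaf) (fun s => (W s).1)
        ⟨cechMRefineC2 B.X.hom (SheafOfModules.unit B.X.left.ringCatSheaf) (fun j => (U j).1) (fun s => (W s).1) τ hτ
            (z : CechMC2 B.X.hom (SheafOfModules.unit B.X.left.ringCatSheaf) (fun j => (U j).1)),
          refineMC2_mem_cechMZ2 B.X.hom (SheafOfModules.unit B.X.left.ringCatSheaf) (fun j => (U j).1) (fun s => (W s).1) τ hτ
            z.2⟩ := by
  haveI : IsSeparated B.X.hom := B.isProper.toIsSeparated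
  haveI : CompactSpace B.X.left := by
    haveI := B.isProper
    exact QuasiCompact.compactSpace_of_compactSpace B.X.hom
  exact CechMH2.mk_refineC2_comapC2_eq_smul_of_ordered B.X (B.mulN 2).left (Over.w (B.mulN 2)) ((2 : k) * 2) U hU
    (fun m e he WΔ hWΔ _ _ _ _ x => AbelianVarietyCech.homologyMap_mulTwo_degree_two B (fun i => U (e i)) he WΔ hWΔ x)
    z W τ τ' hτ hτ'

end Literature.AlgebraicGeometry.AbelianSchemes.AbelianSchemeOver

end
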